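import Summits.Ventures.HodgeRepro2.T7SupportCompactOneVectorStandard
import Summits.Ventures.HodgeRepro2.T7SupportCompactDensePoint
import Summits.Ventures.HodgeRepro2.T7SupportBergmanOneVectorMonomialRegularPoint
import Summits.Ventures.HodgeRepro2.T7SupportDenseRegularProduct

/-!
# The archimedean half of `(b′)` for the one-vector `f` at ALL THREE places, in the model (support, seat p1)

The composite of the one-vector chapter (rows 703–708): at the compact place `ι₁` the standard representation of
`U(2)` with `u_A = e₀` (`T7SupportCompactOneVectorStandard`), at the two rank-one places `ι₂, ι₃` the weight-`k_j`
Bergman models with `u_A = z^{n_j}` and the expansions `c_j` of `π_{k_j}(h_j⁻¹) z^{n_j}` as parameters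
(`T7SupportBergmanOneVectorMonomial`; `n = 0` is row 701, `n = 1` row 705). The Fourier coefficients
`Φ^{(1)}_1(γ₁) = ⟪e₀, std(γ₁ h₁) P_1 std(h₁⁻¹) e₀⟫`, `Φ^{(j)}_{−(k_j+2m_j)}(γ_j) = c_j(m_j) ⟨π_{k_j}(γ_j h_j) z^{m_j}, z^{n_j}⟩`
are continuous in `γ` (`continuous_fourierCoeff_std`, row 706) and non-zero at `γ = 1` exactly under the per-place
`hq_v` (`h₁` with `(h₁)₀₁ ≠ 0`; `c_j(m_j) ≠ 0`), and the non-regular loci `{κ_v = 1}` are closed and nowhere dense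
(rows 680, 695). Row 681's three-place lemma then gives:

  **every dense `S ⊆ U(2) × SU(1,1) × SU(1,1)` contains a `γ₀ = (γ₁, γ₂, γ₃)`, REGULAR at all three places, with all three
  one-vector Fourier coefficients — hence all three two-torus orbital integrals, and their product — non-zero**
  (`exists_mem_dense_regular_fourierCoeff_ne_zero₃`, `exists_mem_dense_regular_torus_orbital_ne_zero₃`).

This is L3-ARGUMENT §2g (5)'s «at a regular rational `γ₀` the product over the three places is non-zero» for the declared
`f`, in the model, with the per-place `hq_v` displayed; what stays in words is that the rational points with the
finite-place conditions form such a dense `S` (Lemma WA′) and the dictionary at the three places.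

Explicit model only; nothing about the adelic group or any period.
Blind lane: Mathlib + the HodgeRepro2 prefix only; no sorry; axioms ⊆ {propext, Classical.choice, Quot.sound}.
-/

namespace Summit.Ventures.HodgeRepro2.T7SupportOneVectorArchimedean

open MeasureTheory Metric
open scoped InnerProductSpace
open T5SU11Unimodular T5SU11Fibration T5BergmanCoefficient T5BergmanMatrixCoeff T5HaarCircle
  T7SupportTwoTorusInvariant T7SupportWeightTorusOrbital T7SupportOneVectorOrbital T7SupportTorusProjector
  T7SupportCompactRegularPoint T7SupportCompactOneVectorStandard T7SupportBergmanOneVectorMonomial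
  T7SupportBergmanOneVectorMonomialRegularPoint T7SupportDenseRegularProduct

variable [MeasurableSpace Circle] [BorelSpace Circle]

/-- **the compact-place Fourier coefficient is continuous in `γ`** -/
theorem continuous_fourierCoeff_std (h : U2) :
    Continuous fun γ : U2 => T7SupportOneVectorOrbital.fourierCoeff std (e 0) h rhoB 1 γ := by
  have e1 : (fun γ : U2 => T7SupportOneVectorOrbital.fourierCoeff std (e 0) h rhoB 1 γ) =
      fun γ => ⟪e 0, std (γ * h) (torusProj std rhoB 1 (std h⁻¹ (e 0)))⟫_ℂ :=
    funext fun γ => fourierCoeff_eq_inner_torusProj isUnitaryRep_std (e 0) h rhoB 1 γ (continuous_std_rhoB _)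
  rw [e1]
  exact continuous_const.inner ((continuous_std_apply _).comp (continuous_id.mul continuous_const))

/-- **a regular point of a dense subset of `U(2) × SU(1,1) × SU(1,1)` where all three one-vector Fourier coefficients
are non-zero** (per-place `hq`: `(h₁)₀₁ ≠ 0`, `c₂(m₂) ≠ 0`, `c₃(m₃) ≠ 0`) -/
theorem exists_mem_dense_regular_fourierCoeff_ne_zero₃ (h₁ : U2) (hb₁ : matU h₁ 0 1 ≠ 0)
    (k₂ : ℕ) (hk₂ : 2 ≤ k₂) (n₂ : ℕ) (h₂ : SU11) (c₂ : ℕ → ℂ)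
    (hc₂ : ∀ z ∈ ball (0 : ℂ) 1, HasSum (fun j => c₂ j * z ^ j) (act k₂ h₂⁻¹ (fun z => z ^ n₂) z)) (m₂ : ℕ)
    (hm₂ : c₂ m₂ ≠ 0)
    (k₃ : ℕ) (hk₃ : 2 ≤ k₃) (n₃ : ℕ) (h₃ : SU11) (c₃ : ℕ → ℂ)
    (hc₃ : ∀ z ∈ ball (0 : ℂ) 1, HasSum (fun j => c₃ j * z ^ j) (act k₃ h₃⁻¹ (fun z => z ^ n₃) z)) (m₃ : ℕ)
    (hm₃ : c₃ m₃ ≠ 0) {S : Set (U2 × SU11 × SU11)} (hS : Dense S) :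
    ∃ γ₀ ∈ S,
      T7SupportOneVectorOrbital.fourierCoeff std (e 0) h₁ rhoB 1 γ₀.1 ≠ 0 ∧
      monomialFourierCoeff k₂ n₂ h₂ (-((k₂ + 2 * m₂ : ℕ) : ℤ)) γ₀.2.1 ≠ 0 ∧
      monomialFourierCoeff k₃ n₃ h₃ (-((k₃ + 2 * m₃ : ℕ) : ℤ)) γ₀.2.2 ≠ 0 ∧
      kappa (starRingEnd ℂ) dd2 (colBasis h₁) (matU γ₀.1) ≠ 1 ∧
      kappa (starRingEnd ℂ) T7SupportKappaCartan.dd (T7SupportKappaCartan.colBasis h₂) (mat γ₀.2.1) ≠ 1 ∧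
      kappa (starRingEnd ℂ) T7SupportKappaCartan.dd (T7SupportKappaCartan.colBasis h₃) (mat γ₀.2.2) ≠ 1 := by
  obtain ⟨s, hsS, h1, h2, h3, hZ1, hZ2, hZ3⟩ := exists_mem_dense_prod₃_ne_zero_notMem hS
    (continuous_fourierCoeff_std h₁) (continuous_monomialFourierCoeff k₂ hk₂ n₂ h₂ c₂ hc₂ m₂)
    (continuous_monomialFourierCoeff k₃ hk₃ n₃ h₃ c₃ hc₃ m₃)
    ⟨1, (hq_std_iff h₁).2 hb₁⟩ ⟨1, (monomialFourierCoeff_one_ne_zero_iff k₂ hk₂ n₂ h₂ c₂ hc₂ m₂).2 hm₂⟩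
    ⟨1, (monomialFourierCoeff_one_ne_zero_iff k₃ hk₃ n₃ h₃ c₃ hc₃ m₃).2 hm₃⟩
    (T7SupportCompactDensePoint.isClosed_kappa_eq_one h₁) (T7SupportCompactDensePoint.interior_kappa_eq_one_eq_empty h₁)
    (T7SupportDenseRegularPoint.isClosed_kappa_eq_one h₂) (T7SupportDenseRegularPoint.interior_kappa_eq_one_eq_empty h₂)
    (T7SupportDenseRegularPoint.isClosed_kappa_eq_one h₃) (T7SupportDenseRegularPoint.interior_kappa_eq_one_eq_empty h₃)
  exact ⟨s, hsS, h1, h2, h3, hZ1, hZ2, hZ3⟩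

/-- **the same for the two-torus orbital integrals: a regular `γ₀` in any dense `S` with the PRODUCT over the three
places non-zero** (characters `(u⁻¹, conj w)` at `ι₁`, `(u^{k_j+2n_j}, conj w^{−(k_j+2m_j)})` at `ι_j`) -/
theorem exists_mem_dense_regular_torus_orbital_ne_zero₃ (h₁ : U2) (hb₁ : matU h₁ 0 1 ≠ 0)
    (k₂ : ℕ) (hk₂ : 2 ≤ k₂) (n₂ : ℕ) (h₂ : SU11) (c₂ : ℕ → ℂ)
    (hc₂ : ∀ z ∈ ball (0 : ℂ) 1, HasSum (fun j => c₂ j * z ^ j) (act k₂ h₂⁻¹ (fun z => z ^ n₂) z)) (m₂ : ℕ)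
    (hm₂ : c₂ m₂ ≠ 0)
    (k₃ : ℕ) (hk₃ : 2 ≤ k₃) (n₃ : ℕ) (h₃ : SU11) (c₃ : ℕ → ℂ)
    (hc₃ : ∀ z ∈ ball (0 : ℂ) 1, HasSum (fun j => c₃ j * z ^ j) (act k₃ h₃⁻¹ (fun z => z ^ n₃) z)) (m₃ : ℕ)
    (hm₃ : c₃ m₃ ≠ 0) {S : Set (U2 × SU11 × SU11)} (hS : Dense S) :
    ∃ γ₀ ∈ S,
      (∫ u : Circle, ∫ w : Circle, coeff std (e 0) (e 0) (rhoA u * γ₀.1 * (h₁ * rhoB w * h₁⁻¹)) *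
          ((u : ℂ) ^ (-(1 : ℤ)) * (starRingEnd ℂ) ((w : ℂ) ^ (1 : ℤ))) ∂haarCircle ∂haarCircle) *
        (∫ u : Circle, ∫ w : Circle,
          matrixCoeff k₂ (fun z => z ^ n₂) (fun z => z ^ n₂) (rot u * γ₀.2.1 * (h₂ * rot w * h₂⁻¹)) *
            ((u : ℂ) ^ ((k₂ + 2 * n₂ : ℕ) : ℤ) * (starRingEnd ℂ) ((w : ℂ) ^ (-((k₂ + 2 * m₂ : ℕ) : ℤ))))
            ∂haarCircle ∂haarCircle) *
        (∫ u : Circle, ∫ w : Circle,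
          matrixCoeff k₃ (fun z => z ^ n₃) (fun z => z ^ n₃) (rot u * γ₀.2.2 * (h₃ * rot w * h₃⁻¹)) *
            ((u : ℂ) ^ ((k₃ + 2 * n₃ : ℕ) : ℤ) * (starRingEnd ℂ) ((w : ℂ) ^ (-((k₃ + 2 * m₃ : ℕ) : ℤ))))
            ∂haarCircle ∂haarCircle) ≠ 0 ∧
      kappa (starRingEnd ℂ) dd2 (colBasis h₁) (matU γ₀.1) ≠ 1 ∧
      kappa (starRingEnd ℂ) T7SupportKappaCartan.dd (T7SupportKappaCartan.colBasis h₂) (mat γ₀.2.1) ≠ 1 ∧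
      kappa (starRingEnd ℂ) T7SupportKappaCartan.dd (T7SupportKappaCartan.colBasis h₃) (mat γ₀.2.2) ≠ 1 := by
  obtain ⟨γ₀, hγS, h1, h2, h3, hZ1, hZ2, hZ3⟩ := exists_mem_dense_regular_fourierCoeff_ne_zero₃ h₁ hb₁ k₂ hk₂ n₂ h₂
    c₂ hc₂ m₂ hm₂ k₃ hk₃ n₃ h₃ c₃ hc₃ m₃ hm₃ hS
  refine ⟨γ₀, hγS, ?_, hZ1, hZ2, hZ3⟩
  rw [torus_orbital_one_vector_eq isUnitaryRep_std isWeightVector_rhoA_e0 h₁ rhoB γ₀.1 (-1) 1, if_pos (by ring),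
    one_mul, torus_orbital_monomial_eq k₂ n₂ hk₂ h₂ γ₀.2.1 _ _, if_pos rfl, one_mul,
    torus_orbital_monomial_eq k₃ n₃ hk₃ h₃ γ₀.2.2 _ _, if_pos rfl, one_mul]
  exact mul_ne_zero (mul_ne_zero h1 h2) h3

end Summit.Ventures.HodgeRepro2.T7SupportOneVectorArchimedean
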